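import Mathlib
import Summits.Ventures.FusionMHD.Models.CerfonFreidbergNstxLikeShapeCert
import Summits.Ventures.FusionMHD.Models.CerfonFreidbergNstxLikePlasmaSection
import HarnessLib

/-!
# Ventures/FusionMHD — Models/CerfonFreidbergNstxLikeShapeFidelity.lean: HOW D-SHAPED IS THE CERFON–FREIDBERG
# NSTX-LIKE MODEL PLASMA? For every real `τ`: `−2.8·10⁻⁴ ≤ U ≤ 8·10⁻⁵` along Freidberg's printed reference surface (6.154)
# (both signs taken), i.e. the printed D-shape is the model flux surface `ψ_N = 1` only to `|ψ_N − 1| ≤ 1.2·10⁻³` — about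
# FIFTY times the ITER-like mismatch — and `|Y² − Y⋆²| ≤ 7/125` along every vertical line of the box (NSTX-like TWIN of
# `Models/CerfonFreidbergIterLikeShapeFidelity.lean`; a kernel MODEL-VALIDITY certificate of the Cerfon–Freidberg boundary fit)

HONEST FRAMING (LADDER-GRIDFUSION three columns; CF rung; companion of S2 #47 «F1.CF-AXIS-NSTX» and of every row that uses THE
Cerfon–Freidberg NSTX-like instance of record `CFNstxLike.U` — `Models/CerfonFreidbergNstxLikeAxisCert.lean`).  Same construction
as the ITER-like twin, for the printed NSTX-like triple `(ε, κ, δ) = (39/50, 2, 7/20)` (Pataki–Cerfon–Freidberg 2013 §6.1): seven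
point / slope / curvature conditions (6.155) on the reference surface `X = 1 + ε cos(τ + δ₀ sin τ)`, `Y = εκ sin τ` (6.154),
`δ₀ = arcsin δ`; the model plasma boundary is `{U = 0}` (ONE lens `|Y| < Y⋆(X)` in the tall box `[11/50, 89/50] × [−8/5, 8/5]`,
`Models/…NstxLikePlasmaSection.lean`).  On top of the Taylor-model range certificate of `Models/CerfonFreidbergNstxLikeShapeCert.lean`
(`refProg_bounds_Icc` on `[0, 3217/1024] ⊃ [0, π]`):

* §4 evenness (`U_even`) and `2π`-periodicity: **`U_referenceSurface_bounds`: `−28/10⁵ ≤ U(X(τ), Y(τ)) ≤ 8/10⁵` for every real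
  `τ`**; TIGHTNESS: `U ≤ −23/10⁵` at `τ = 201/256` (INSIDE the model plasma), `U ≥ 6/10⁵` at `τ = 151/64` (OUTSIDE);
* §5 `ψ_N := 1 − U/U_axis` (`U_axis ≤ −0.2429878` by #47): **`abs_psiN_referenceSurface_sub_one_le`: `|ψ_N − 1| ≤ 3/2500` on the whole
  printed D-shape** (ITER-like twin: `1/40000`); and with `Y⋆(X)` the half-height of the model plasma (`Ystar_spec`) and
  `U_Y = 2Y·H`, `H ≥ 1/200` on the tall box (`vertSlope_lb_tall`): **`sq_sub_Ystar_sq_le`: `|Y(τ)² − Y⋆(X(τ))²| ≤ 7/125`** for every `τ`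
  whose abscissa lies on the open chord `(11/50, 89/50)` (half-height `κε = 1.56`; e.g. `≤ 2.8·10⁻²` apart in `Y` wherever `|Y| ≥ 1`).

So the 7-term Cerfon–Freidberg fit, excellent for the ITER-like shape, is visibly coarser at the NSTX-like aspect ratio and
elongation — a quantitative MODEL-VALIDITY statement the source gives only as a figure.  CERTIFIED (kernel): exactly the statements
above, for THE model flux.  VALIDATED (never used): Arb lineage bench/F2-CF-NSTX-alpha0-lineage1.json 0dec53189869c976 (max |U| =
2.39·10⁻⁴).  MODELLED: analytic Cerfon–Freidberg family (ideal MHD, Solov'ev profiles `A = 0`, fixed analytic boundary); nothing about a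
device or stability.  Typer/prover: gridfusion-model-5 (g6), 2026-08-27.
Citations: Freidberg 2014 §6.6.1 (6.153)–(6.156) [Freidberg2014]; Cerfon–Freidberg 2010 [CerfonFreidberg2010];
Pataki–Cerfon–Freidberg 2013 §6.1 [PatakiCerfonFreidberg2013].
-/

noncomputable section

open Set
open Literature.Analysis.ValidatedNumerics Literature.Analysis.ValidatedNumerics.PolyMP
open Literature.MathematicalPhysics.MHD Literature.MathematicalPhysics.MHD.CerfonFreidberg _root_.Real

namespace Summit.Ventures.FusionMHD.Models.CFNstxLike

/-! ## §4 Evenness and periodicity in `τ`; the bound on the whole reference curve -/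

/-- The reference curve at `−τ` is the mirror image of the curve at `τ`, and `U` is even in `Y`. -/
theorem refUN_neg (τ : ℝ) : CFNstxLike.refU (-τ) = CFNstxLike.refU τ := by
  unfold refU
  rw [referenceSurface_fst, referenceSurface_snd, referenceSurface_fst, referenceSurface_snd]
  have e1 : -τ + δ₀ * Real.sin (-τ) = -(τ + δ₀ * Real.sin τ) := by rw [Real.sin_neg]; ring
  rw [e1, Real.cos_neg, Real.sin_neg, mul_neg, U_even]

/-- `2π`-periodicity (integer multiples). -/
theorem refUN_add_int_mul (τ : ℝ) (n : ℤ) : CFNstxLike.refU (τ + n * (2 * π)) = CFNstxLike.refU τ := by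
  unfold refU
  rw [referenceSurface_fst, referenceSurface_snd, referenceSurface_fst, referenceSurface_snd,
    Real.sin_add_int_mul_two_pi]
  have e : τ + n * (2 * π) + δ₀ * Real.sin τ = (τ + δ₀ * Real.sin τ) + n * (2 * π) := by ring
  rw [e, Real.cos_add_int_mul_two_pi]

/-- Reduction of any `τ` to `[0, π]`. -/
theorem existsN_reduce (τ : ℝ) : ∃ θ : ℝ, 0 ≤ θ ∧ θ ≤ π ∧ CFNstxLike.refU τ = CFNstxLike.refU θ := by
  have hπ := Real.pi_pos
  set n := ⌊(τ + π) / (2 * π)⌋ with hn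
  have h1 : (n : ℝ) ≤ (τ + π) / (2 * π) := Int.floor_le _
  have h2 : (τ + π) / (2 * π) < n + 1 := Int.lt_floor_add_one _
  rw [le_div_iff₀ (by positivity)] at h1
  rw [div_lt_iff₀ (by positivity)] at h2
  set θ := τ - n * (2 * π) with hθ
  have hper : refU τ = refU θ := by
    have e : τ = θ + n * (2 * π) := by rw [hθ]; ring
    conv_lhs => rw [e]
    exact refUN_add_int_mul θ n
  by_cases hs : 0 ≤ θ
  · exact ⟨θ, hs, by linarith, hper⟩
  · refine ⟨-θ, by linarith, by linarith, ?_⟩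
    rw [hper, refUN_neg]

/-- **THE RANGE THEOREM:** for every real `τ`, `−28/10⁵ ≤ U(X(τ), Y(τ)) ≤ 8/10⁵` along the printed reference
surface (6.154) of THE Cerfon–Freidberg NSTX-like instance. -/
theorem U_referenceSurface_bounds (τ : ℝ) :
    -(28 : ℝ) / 10 ^ 5 ≤ U (referenceSurface ε κ δ₀ τ).1 (referenceSurface ε κ δ₀ τ).2 ∧
      U (referenceSurface ε κ δ₀ τ).1 (referenceSurface ε κ δ₀ τ).2 ≤ 8 / 10 ^ 5 := by
  obtain ⟨θ, h0, h1, heq⟩ := existsN_reduce τ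
  have hπ : θ ≤ ((piBar : ℚ) : ℝ) := h1.trans (by have := Real.pi_lt_d6; norm_num [piBar]; linarith)
  have h := refProg_bounds_Icc h0 hπ
  rw [← refU_eq_toFunP, ← heq] at h
  have e1 : (((uLo : ℚ) : ℚ) : ℝ) = -(28 : ℝ) / 10 ^ 5 := by norm_num [uLo]
  have e2 : (((uHi : ℚ) : ℚ) : ℝ) = (8 : ℝ) / 10 ^ 5 := by norm_num [uHi]
  rw [e1, e2] at h
  exact h

/-- Corollary: **`|U| < 3·10⁻⁴` on the whole reference curve.** -/
theorem abs_U_referenceSurface_lt (τ : ℝ) :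
    |U (referenceSurface ε κ δ₀ τ).1 (referenceSurface ε κ δ₀ τ).2| < 3 / 10 ^ 4 := by
  obtain ⟨h1, h2⟩ := U_referenceSurface_bounds τ
  rw [abs_lt]; constructor <;> linarith

/-- **Tightness, inside:** at `τ = 201/256` the reference point lies INSIDE the model plasma, `U ≤ −23/10⁵`. -/
theorem U_referenceSurface_inside :
    U (referenceSurface ε κ δ₀ (201 / 256)).1 (referenceSurface ε κ δ₀ (201 / 256)).2 ≤ -(23 : ℝ) / 10 ^ 5 := by
  have h := pointIn_ok
  simp only [pointIn, Bool.and_eq_true, decide_eq_true_eq] at h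
  have hb := le_of_pointModel h.1 h.2 boxMem_params
  have e : refU (201 / 256) = refProg.toFunP params (((201 / 256 : ℚ) : ℚ) : ℝ) := by
    rw [refU_eq_toFunP]; norm_num
  rw [refU] at e
  rw [e]
  refine hb.trans ?_
  norm_num

/-- **Tightness, outside:** at `τ = 151/64` the reference point lies OUTSIDE the model plasma, `U ≥ 6/10⁵`. -/
theorem U_referenceSurface_outside :
    (6 : ℝ) / 10 ^ 5 ≤ U (referenceSurface ε κ δ₀ (151 / 64)).1 (referenceSurface ε κ δ₀ (151 / 64)).2 := by
  have h := pointOut_ok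
  simp only [pointOut, Bool.and_eq_true, decide_eq_true_eq] at h
  have hb := ge_of_pointModel h.1 h.2 boxMem_params
  have e : refU (151 / 64) = refProg.toFunP params (((151 / 64 : ℚ) : ℚ) : ℝ) := by
    rw [refU_eq_toFunP]; norm_num
  rw [refU] at e
  rw [e]
  refine le_trans ?_ hb
  norm_num

/-! ## §5 Corollaries: normalised flux on the printed D-shape; vertical gap to the model separatrix -/

/-- Normalised poloidal flux of the model: `ψ_N = 1 − U/U_axis` (`0` on the magnetic axis, `1` on `{U = 0}`). -/
def psiN (X Y : ℝ) : ℝ := 1 - U X Y / U Xa 0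

/-- **`|ψ_N − 1| ≤ 3/2500 = 1.2·10⁻³` on the whole printed reference surface** (the D-shape (6.154) is the flux
surface `ψ_N = 1` of the model to that accuracy; ITER-like twin: `1/40000`). -/
theorem abs_psiN_referenceSurface_sub_one_le (τ : ℝ) :
    |psiN (referenceSurface ε κ δ₀ τ).1 (referenceSurface ε κ δ₀ τ).2 - 1| ≤ 3 / 2500 := by
  obtain ⟨h1, h2⟩ := U_referenceSurface_bounds τ
  obtain ⟨ha1, ha2⟩ := U_axis_bounds
  set u := U (referenceSurface ε κ δ₀ τ).1 (referenceSurface ε κ δ₀ τ).2 with hu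
  have hne : U Xa 0 ≠ 0 := by linarith
  have hneg : U Xa 0 < 0 := by linarith
  rw [psiN, show 1 - u / U Xa 0 - 1 = -(u / U Xa 0) by ring, abs_neg, abs_div, div_le_iff₀ (abs_pos.mpr hne),
    abs_of_neg hneg]
  rw [abs_le]
  constructor <;> nlinarith

/-- The vertical profile `W ↦ G₀ + G₂ W + G₄ W² + G₆ W³` (`U(X, Y)` at `W = Y²`). -/
def vertProfile (X W : ℝ) : ℝ := vertG₀ coeff X + vertG₂ coeff X * W + vertG₄ coeff X * W ^ 2 + vertG₆ coeff X * W ^ 3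

/-- `U(X, Y) = vertProfile X (Y²)` (NSTX-like instance). -/
theorem UN_eq_vertProfile (X Y : ℝ) : CFNstxLike.U X Y = CFNstxLike.vertProfile X (Y ^ 2) := by
  rw [U_eq_vert, vertProfile]; ring

/-- Derivative of the NSTX-like vertical profile in `W`. -/
theorem hasDerivAt_vertProfileN (X W : ℝ) :
    HasDerivAt (CFNstxLike.vertProfile X)
      (vertG₂ CFNstxLike.coeff X + 2 * vertG₄ CFNstxLike.coeff X * W + 3 * vertG₆ CFNstxLike.coeff X * W ^ 2) W := by
  unfold vertProfile
  refine HasDerivAt.congr_deriv ?_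
    (show 0 + vertG₂ coeff X * 1 + vertG₄ coeff X * (2 * W ^ 1 * 1) + vertG₆ coeff X * (3 * W ^ 2 * 1) = _ by ring)
  exact (((hasDerivAt_const W (vertG₀ coeff X)).add ((hasDerivAt_id W).const_mul (vertG₂ coeff X))).add
    (((hasDerivAt_id W).pow 2).const_mul (vertG₄ coeff X))).add (((hasDerivAt_id W).pow 3).const_mul (vertG₆ coeff X))

/-- **The vertical slope bound as a Lipschitz-from-below inequality:** for `0 ≤ W₁ ≤ W₂ ≤ 64/25` and `X` on the chord,
`(W₂ − W₁)/200 ≤ vertProfile X W₂ − vertProfile X W₁` (mean value inequality with `H ≥ 1/200`, `vertSlope_lb_tall`). -/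
theorem vertProfile_sub_ge {X W₁ W₂ : ℝ} (hX1 : (11 : ℝ) / 50 ≤ X) (hX2 : X ≤ 89 / 50) (h0 : 0 ≤ W₁) (h12 : W₁ ≤ W₂)
    (h2 : W₂ ≤ 64 / 25) : 1 / 200 * (W₂ - W₁) ≤ vertProfile X W₂ - vertProfile X W₁ := by
  have hD : Convex ℝ (Icc (0 : ℝ) (64 / 25)) := convex_Icc _ _
  have hcont : ContinuousOn (vertProfile X) (Icc (0 : ℝ) (64 / 25)) :=
    fun W _ => (hasDerivAt_vertProfileN X W).continuousAt.continuousWithinAt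
  have hdiff : DifferentiableOn ℝ (vertProfile X) (interior (Icc (0 : ℝ) (64 / 25))) :=
    fun W _ => (hasDerivAt_vertProfileN X W).differentiableAt.differentiableWithinAt
  have hge : ∀ W ∈ interior (Icc (0 : ℝ) (64 / 25)), (1 : ℝ) / 200 ≤ deriv (vertProfile X) W := by
    intro W hW
    rw [interior_Icc] at hW
    rw [(hasDerivAt_vertProfileN X W).deriv]
    have hs : (Real.sqrt W) ^ 2 = W := Real.sq_sqrt hW.1.le
    have h4 : (Real.sqrt W) ^ 4 = W ^ 2 := by rw [show (4 : ℕ) = 2 * 2 from rfl, pow_mul, hs]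
    have hb := vertSlope_lb_tall hX1 hX2 (Y := Real.sqrt W) (by rw [hs]; exact hW.2.le)
    rw [hs, h4] at hb
    linarith
  exact hD.mul_sub_le_image_sub_of_le_deriv hcont hdiff hge W₁ ⟨h0, h12.trans h2⟩ W₂ ⟨h0.trans h12, h2⟩ h12

/-- **THE VERTICAL GAP:** for every `τ` whose reference abscissa `X(τ)` lies on the open chord `(11/50, 89/50)`,
`|Y(τ)² − Y⋆(X(τ))²| ≤ 7/125`, `Y⋆` the half-height of the model plasma (`Ystar`): the printed D-shape and
the model separatrix differ by at most that much in `Y²` along the vertical through `X(τ)`. -/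
theorem sq_sub_Ystar_sq_le (τ : ℝ) (hX : (referenceSurface ε κ δ₀ τ).1 ∈ Ioo (11 / 50 : ℝ) (89 / 50)) :
    |(referenceSurface ε κ δ₀ τ).2 ^ 2 - Ystar (referenceSurface ε κ δ₀ τ).1 ^ 2| ≤ 7 / 125 := by
  set X := (referenceSurface ε κ δ₀ τ).1 with hXdef
  set Y := (referenceSurface ε κ δ₀ τ).2 with hYdef
  obtain ⟨⟨hs0, hs1⟩, hzero, -, -⟩ := Ystar_spec hX
  obtain ⟨hb1, hb2⟩ := U_referenceSurface_bounds τ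
  rw [← hXdef, ← hYdef] at hb1 hb2
  have hY2 : Y ^ 2 ≤ 64 / 25 := by
    have e : Y = ε * κ * Real.sin τ := by rw [hYdef, referenceSurface_snd]
    have hs := Real.sin_sq_le_one τ
    rw [e]; unfold ε κ; nlinarith
  have hYs2 : Ystar X ^ 2 ≤ 64 / 25 := by nlinarith
  have hU1 : U X Y = vertProfile X (Y ^ 2) := UN_eq_vertProfile X Y
  have hU2 : vertProfile X (Ystar X ^ 2) = 0 := by rw [← UN_eq_vertProfile]; exact hzero
  rw [abs_le]
  rcases le_total (Y ^ 2) (Ystar X ^ 2) with hle | hle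
  · have h := vertProfile_sub_ge hX.1.le hX.2.le (sq_nonneg Y) hle hYs2
    rw [hU2, ← hU1] at h
    constructor <;> nlinarith
  · have h := vertProfile_sub_ge hX.1.le hX.2.le (sq_nonneg _) hle hY2
    rw [hU2, ← hU1] at h
    constructor <;> nlinarith

end Summit.Ventures.FusionMHD.Models.CFNstxLike
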